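import Mathlib.Algebra.BigOperators.Pi
import Mathlib.Algebra.BigOperators.Ring.Finset
import Mathlib.Algebra.Module.BigOperators
import Mathlib.Data.Fintype.BigOperators
import Mathlib.GroupTheory.Perm.Basic
import Mathlib.Data.Fintype.Perm
import Mathlib.Analysis.SpecialFunctions.Complex.Circle
import HarnessLib

/-!
# Index bookkeeping for the end-state sum of the «method of §8.2»: regrouping `Σ_{ρ : W → S₃}` by the wall class `ρ_v⁻¹(1)` ((R1-h-d) (D1))
(Rogawski (1990) §8.2 pp. 122–124: the classes `γ, γ₁, γ₂` of a split-singular torus point; §14.5 p. 238)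

Topic `NumberTheory/Rogawski1990`; namespace `Literature.NumberTheory.Rogawski1990.WallIndex`.  THEOREMS ONLY — pure finite combinatorics (no measure theory, no definition,
no instance, no notation, no named fact, no `sorry`).  Cell `hodgecm-mathlib`, crux H413 (`stmt-HodgeConjecture-24833`); (R1-h-d) plan of F0P3a-p07 (g8) 07:08:19Z, step (D1)
«INDEX BOOKKEEPING» cut by F0P3-p03 (g9) (consumer) in parallel with p07 (g8)'s (D0); LEAD F0P3a-plan (g9) WORD T8-104 (2).  Count-neutral; HC_CM is proved only modulo the printed
citations until rung 0 closes.

THE POINT.  The end state of ★ p841776 ∕ (D0-3) is a sum over `ρ : W → Perm (Fin 3)` (one relabelling per indefinite place) of `(∏_v κ_v(ρ_v)) • T(z⁰ ∘ ρ)`, and the term `T` depends on `ρ_v`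
only through the WALL CLASS of the relabelled point `z⁰_v ∘ ρ_v`, i.e. through the slot `ρ_v⁻¹(1)` carrying the odd eigenvalue (`z⁰_v 0 = z⁰_v 2`:
`comp_perm_eq_update_of_wall`).  Regrouping the `6^{|W|}` terms by `j = (ρ_v⁻¹ 1)_v : W → Fin 3` gives `3^{|W|}` class terms with PRODUCT coefficients
`∏_v (Σ_{ρ_v : ρ_v⁻¹ 1 = j_v} κ_v(ρ_v))` (`sum_pi_prod_smul_eq_sum_fiber`, any key `S → J`); per place the inner sum has two summands (the two relabellings of a class,
`card_filter_symm_one_eq`), which (D2) evaluates as `2·C_v` ∕ `2·(mass)` etc.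

## References
* [Rogawski1990] J. D. Rogawski, *Automorphic Representations of Unitary Groups in Three Variables*, Ann. of Math. Stud. 123 (1990), §8.2 pp. 122–124, §14.5 p. 238.
* [BrockerTomDieck1985] T. Bröcker, T. tom Dieck, *Representations of Compact Lie Groups* (1985), IV (3.2) (the Weyl group `S₃` of `U(3)` acting on the diagonal torus by relabelling).
-/

set_option autoImplicit false

open Finset

namespace Literature.NumberTheory.Rogawski1990.WallIndex

/-! ## §1 Fibre regrouping of a product-weighted sum over `W → S` by a key `S → J` -/

/-- **REGROUPING BY A KEY.**  For finite `W`, `S`, `J`, a key `key : S → J`, weights `f : W → S → R` and a term `F : (W → J) → M` depending on `ρ : W → S` only through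
`key ∘ ρ`:  `Σ_{ρ : W → S} (∏_v f v (ρ v)) • F (key ∘ ρ) = Σ_{j : W → J} (∏_v Σ_{s : key s = j v} f v s) • F j` (fibres of `ρ ↦ key ∘ ρ` are the boxes
`Π_v key⁻¹(j v)`; `Finset.prod_univ_sum`). [cite: Rogawski1990, §8.2 pp. 122–124] -/
theorem sum_pi_prod_smul_eq_sum_fiber {W : Type*} [Fintype W] [DecidableEq W] {S : Type*} [Fintype S] [DecidableEq S] {J : Type*} [Fintype J] [DecidableEq J]
    {R : Type*} [CommSemiring R] {M : Type*} [AddCommMonoid M] [Module R M]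
    (key : S → J) (f : W → S → R) (F : (W → J) → M) :
    ∑ ρ : W → S, (∏ v, f v (ρ v)) • F (fun v => key (ρ v)) =
      ∑ j : W → J, (∏ v, ∑ s ∈ univ.filter (fun s => key s = j v), f v s) • F j := by
  rw [← sum_fiberwise_of_maps_to (s := (univ : Finset (W → S))) (t := (univ : Finset (W → J))) (g := fun ρ : W → S => fun v => key (ρ v))
    (fun _ _ => mem_univ _)]
  refine sum_congr rfl fun j _ => ?_
  have hF : ∀ ρ ∈ univ.filter (fun ρ : W → S => (fun v => key (ρ v)) = j),
      (∏ v, f v (ρ v)) • F (fun v => key (ρ v)) = (∏ v, f v (ρ v)) • F j := fun ρ hρ => by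
    rw [(mem_filter.1 hρ).2]
  rw [sum_congr rfl hF, ← sum_smul, prod_univ_sum]
  congr 1
  refine sum_congr ?_ fun _ _ => rfl
  ext ρ
  simp only [mem_filter, mem_univ, true_and, Fintype.mem_piFinset, funext_iff]

/-- The same with the term written `F (key ∘ ρ)` through an arbitrary function `T` of `ρ` that FACTORS through the key (`hT : ∀ ρ, T ρ = F (key ∘ ρ)`).
[cite: Rogawski1990, §8.2 pp. 122–124] -/
theorem sum_pi_prod_smul_eq_sum_fiber_of_eq {W : Type*} [Fintype W] [DecidableEq W] {S : Type*} [Fintype S] [DecidableEq S] {J : Type*} [Fintype J] [DecidableEq J]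
    {R : Type*} [CommSemiring R] {M : Type*} [AddCommMonoid M] [Module R M]
    (key : S → J) (f : W → S → R) (T : (W → S) → M) (F : (W → J) → M) (hT : ∀ ρ, T ρ = F (fun v => key (ρ v))) :
    ∑ ρ : W → S, (∏ v, f v (ρ v)) • T ρ = ∑ j : W → J, (∏ v, ∑ s ∈ univ.filter (fun s => key s = j v), f v s) • F j := by
  simp_rw [hT]
  exact sum_pi_prod_smul_eq_sum_fiber key f F

/-! ## §2 The key of a relabelled split-singular torus point: the slot `ρ⁻¹(1)` of the odd eigenvalue -/

/-- **A RELABELLED WALL POINT DEPENDS ON `ρ` ONLY THROUGH `ρ⁻¹(1)`**: if `z 0 = z 2` then `z ∘ ρ = update (const (z 0)) (ρ⁻¹ 1) (z 1)` for every `ρ ∈ S₃`.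
[cite: Rogawski1990, §8.2 p. 122] [cite: BrockerTomDieck1985, IV (3.2)] -/
theorem comp_perm_eq_update_of_wall {α : Type*} (z : Fin 3 → α) (h02 : z 0 = z 2) (ρ : Equiv.Perm (Fin 3)) :
    (fun i => z (ρ i)) = Function.update (fun _ => z 0) (ρ.symm 1) (z 1) := by
  funext i
  by_cases hi : i = ρ.symm 1
  · subst hi
    simp
  · have hne : ρ i ≠ 1 := fun h => hi (by rw [← h, Equiv.symm_apply_apply])
    rw [Function.update_of_ne hi]
    generalize hk : ρ i = k at hne
    fin_cases k
    · rfl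
    · exact absurd rfl hne
    · exact h02.symm

/-- The relabelled STANDARD CURVE point `(z⁰_i · e^{i v_i ψ})_i ∘ ρ` is NOT a class function of `ρ` — only its wall limit `ψ = 0` is; this lemma records the `ψ = 0` reading used by
the end state: `(fun i => z (ρ i) * 1) = update (const (z 0)) (ρ⁻¹ 1) (z 1)` under `z 0 = z 2`. [cite: Rogawski1990, §8.2 p. 122] -/
theorem comp_perm_mul_one_eq_update_of_wall {α : Type*} [MulOneClass α] (z : Fin 3 → α) (h02 : z 0 = z 2) (ρ : Equiv.Perm (Fin 3)) :
    (fun i => z (ρ i) * 1) = Function.update (fun _ => z 0) (ρ.symm 1) (z 1) := by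
  simp only [mul_one]
  exact comp_perm_eq_update_of_wall z h02 ρ

/-- **EACH WALL CLASS HAS EXACTLY TWO RELABELLINGS**: `#{ρ ∈ S₃ : ρ⁻¹ 1 = j} = 2` for every slot `j : Fin 3` (the two orderings of the remaining two labels).
[cite: BrockerTomDieck1985, IV (3.2)] -/
theorem card_filter_symm_one_eq : ∀ j : Fin 3, (univ.filter (fun ρ : Equiv.Perm (Fin 3) => ρ.symm 1 = j)).card = 2 := by
  decide

/-- The per-place inner sum of the regrouping over a wall class, written as a sum over the two relabellings of the class: for `g : Perm (Fin 3) → R`,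
`Σ_{ρ : ρ⁻¹ 1 = j} g ρ = Σ_{ρ ∈ that 2-element set} g ρ` is what (D2) evaluates; here the trivial but used reading `Σ_{ρ : ρ⁻¹ 1 = j} c = 2 • c` for a CONSTANT weight.
[cite: Rogawski1990, §8.2 p. 123] -/
theorem sum_filter_symm_one_const {R : Type*} [AddCommMonoid R] (j : Fin 3) (c : R) :
    ∑ _ρ ∈ univ.filter (fun ρ : Equiv.Perm (Fin 3) => ρ.symm 1 = j), c = 2 • c := by
  rw [sum_const, card_filter_symm_one_eq j]

end Literature.NumberTheory.Rogawski1990.WallIndex
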